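import Summits.Ventures.Crystal3D.Theorems.StickyWulffConstantTextureLiminfTexShadowFccPricedPair
import Summits.Ventures.Crystal3D.Theorems.StickyWulffConstantTextureLiminfTexShadowFccCoaxialPair
import Summits.Ventures.Crystal3D.Theorems.StickyWulffConstantTextureLiminfTexShadowBothFccDefs
import HarnessLib

/-!
# TexShadow — the `BothFcc` DISPATCHER: one presented fcc|fcc plate pair, any registered class, from lane F's UNIFORM cell
# matrix at `(C_F, R₀)` (debt F-U, consumed as a hypothesis in the shape cf-p1 fixed in DECISION (xlv⁗)) and lane G's payer pools
# (lane T, crux `TextureLiminf`, stmt-Ventures-19483; line `TexShadow` v6.17 → v6.18)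

HONEST FRAMING. Venture `Summits/Ventures/Crystal3D` (cell `crystal3d-full`), helper `--supports` the crux `TextureLiminf`
(stmt-Ventures-19483) of `route-Ventures-StickyWulffConstant`, registered line `TexShadow`.  Rung credit only; F-C1 not moved.
Pure proof, standard axioms, no new definitions; inputs BY NAME: `ExactOnly`(C12-55) [E1], `DoubleStarCoaxialAt`/`CapPairCoaxial`
[from `StarPairFar`], and lane F's uniform matrix AT ONE THICKNESS as an explicit hypothesis `hFU` (NOT a def of this file:
the def `CoaxialTwoSlabAdhesionUnifFrom` is lane F's to type, 19481-p2; `hFU` below is its matrix at `(C_F, R₀)` verbatim in the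
(xlv⁗) shape `∀ A₁ t₁ A₂ t₂, coax → distinct → ∃ (L s₁ s₂ σ σ′ shared-frame data) ∧ ∀ h ρ X P₁ P₂ …cell…`).

**`bilayerWallAt_of_bothFcc`** — for `R₀ ≥ 10` and every presented pair `(Lₖ, sₖ, σₖ)` with `BothFcc σ₁ σ₂`, bilayer frames
`BilayerFramesAt`, an admissible table `c`, `hgen : ¬InResidualClass` at the frame pair `(0,0)` and OUTSIDE the six `Σ9` cells and
`SeparatedWide` at `(0,0)` ((β-iii), waits for L-2, cf-p1 22:31:11Z):
`BilayerWallAt (max (C_F + 60√2π) ((4000(1+2(R₀−10)) + 3456 + 1152(R₀+1))/2)) R₀ σ₁ σ₂ L₁ L₂ s₁ s₂ c`.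
Dispatch (`exists_affine_fcc_pair_of_bothFcc`): (α=) equal linear lattices ⇒ zero cell (`bilayerWallAt_of_equal_linear`);
(α≠) co-axial distinct ⇒ `hFU` + `bilayerWallAt_of_coaxialCell` (`affine_coax_of_coAx`, `affine_ne_of_linear_ne`);
(β) non-co-axial ⇒ `bilayerWallAt_of_not_coAx_offSigma9`; constants merged by `bilayerWallAt_mono`.
So the v6.18 `…Fcc` stub is: `intro R₀ hR₀; obtain ⟨C_F, hFU⟩ := stub_coaxialTwoSlabAdhesionUnif … R₀ hR₀; exact ⟨_, bilayerWallAt_of_bothFcc …⟩`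
— quantifier plumbing only.
WHAT THIS IS NOT: not (β-iii); not the faulted plates (T-F2); not F-U itself; F-C1 not moved.
-/

noncomputable section

open scoped BigOperators InnerProductSpace ENNReal
open MeasureTheory

namespace Summit.Ventures.Crystal3D.Theorems

open Summit.Ventures.Crystal3D Finset
open Literature.MathematicalPhysics.StatisticalMechanics (fccStacking barlowStacking IsHaggSeq contactDeficiency)
open Summit.Ventures.Crystal3D.Cruxes.TextureLiminf.TexShadow (E3 e₃ fccRef stacking laySlab cyl CoAx BilayerFramesAt
  BilayerChargeAdmissible InResidualClass BilayerWallAt BothFcc exists_affine_fcc_pair_of_bothFcc bilayerWallAt_mono)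

open scoped Classical in
/-- **The `BothFcc` dispatcher.**  Lane F's uniform co-axial matrix at `(C_F, R₀)` (hypothesis `hFU`, the (xlv⁗) shape), lane G's
payer pools (through …FccPricedPair) and the zero cell give the wall-cell inequality for EVERY presented `BothFcc` pair whose `(0,0)`
bilayer-frame pair is `¬InResidualClass` and outside the `Σ9`/separated-wide cells, at the pair-free constant
`max (C_F + 60√2π) ((4000(1+2(R₀−10)) + 3456 + 1152(R₀+1))/2)`, `R₀ ≥ 10`. -/
theorem bilayerWallAt_of_bothFcc
    {s₀ : E3} (hs₀ : s₀ ∈ fccSlots) (hcert : ExactOnly 0 (fccSlots.filter fun w => 0 < ⟪w, s₀⟫_ℝ))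
    (hDS : ∀ G₁ G₂ : E3 ≃ₗᵢ[ℝ] E3, DoubleStarCoaxialAt G₁ G₂) (hCP : CapPairCoaxial)
    {R₀ C_F : ℝ} (hR₀ : 10 ≤ R₀)
    (hFU : ∀ (P₁ : E3 ≃ₗᵢ[ℝ] E3) (t₁ : E3) (P₂ : E3 ≃ₗᵢ[ℝ] E3) (t₂ : E3),
      (∃ (L : E3 ≃ₗᵢ[ℝ] E3) (r₁ r₂ : E3) (σ σ' : ℤ → ℤ), IsHaggSeq σ ∧ IsHaggSeq σ' ∧
          (fun p => P₁ p + t₁) '' fccStacking 1 (Real.sqrt (2 / 3)) ⊆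
            (fun p => L p + r₁) '' barlowStacking 1 (Real.sqrt (2 / 3)) σ ∧
          (fun p => P₂ p + t₂) '' fccStacking 1 (Real.sqrt (2 / 3)) ⊆
            (fun p => L p + r₂) '' barlowStacking 1 (Real.sqrt (2 / 3)) σ') →
      (fun p => P₁ p + t₁) '' fccStacking 1 (Real.sqrt (2 / 3)) ≠
        (fun p => P₂ p + t₂) '' fccStacking 1 (Real.sqrt (2 / 3)) →
      ∃ (L : E3 ≃ₗᵢ[ℝ] E3) (r₁ r₂ : E3) (σ σ' : ℤ → ℤ), IsHaggSeq σ ∧ IsHaggSeq σ' ∧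
        (fun p => P₁ p + t₁) '' fccStacking 1 (Real.sqrt (2 / 3)) ⊆
          (fun p => L p + r₁) '' barlowStacking 1 (Real.sqrt (2 / 3)) σ ∧
        (fun p => P₂ p + t₂) '' fccStacking 1 (Real.sqrt (2 / 3)) ⊆
          (fun p => L p + r₂) '' barlowStacking 1 (Real.sqrt (2 / 3)) σ' ∧
        ∀ h : ℝ, 0 ≤ h → ∀ ρ : ℝ, R₀ ≤ ρ → ∀ X Q₁ Q₂ : Finset E3,
          (∀ p ∈ X, ∀ q ∈ X, p ≠ q → 1 ≤ dist p q) → Q₁ ⊆ X → Q₂ ⊆ X \ Q₁ →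
          (∀ p ∈ X, -(2 * R₀) ≤ p 2 ∧ p 2 ≤ h + 2 * R₀ ∧ p 0 ^ 2 + p 1 ^ 2 ≤ ρ ^ 2) →
          (∀ p, p ∈ Q₁ ↔ (p ∈ (fun q => P₁ q + t₁) '' fccStacking 1 (Real.sqrt (2 / 3)) ∧
            -(2 * R₀) ≤ p 2 ∧ p 2 ≤ -R₀ ∧ p 0 ^ 2 + p 1 ^ 2 ≤ ρ ^ 2)) →
          (∀ p, p ∈ Q₂ ↔ (p ∈ (fun q => P₂ q + t₂) '' fccStacking 1 (Real.sqrt (2 / 3)) ∧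
            h + R₀ ≤ p 2 ∧ p 2 ≤ h + 2 * R₀ ∧ p 0 ^ 2 + p 1 ^ 2 ≤ ρ ^ 2)) →
          ((((Q₁ ×ˢ (X \ Q₁)).filter fun pq => dist pq.1 pq.2 = 1).card : ℕ) : ℝ) +
            ((((Q₂ ×ˢ ((X \ Q₁) \ Q₂)).filter fun pq => dist pq.1 pq.2 = 1).card : ℕ) : ℝ) ≤
            contactDeficiency ((X \ Q₁) \ Q₂) +
              (Real.sqrt 2 / 4 * ∑ᶠ w ∈ {w ∈ fccStacking 1 (Real.sqrt (2 / 3)) | ‖w‖ = 1},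
                  |⟪w, P₁.symm (EuclideanSpace.single (2 : Fin 3) (1 : ℝ))⟫_ℝ| +
                Real.sqrt 2 / 4 * ∑ᶠ w ∈ {w ∈ fccStacking 1 (Real.sqrt (2 / 3)) | ‖w‖ = 1},
                  |⟪w, P₂.symm (EuclideanSpace.single (2 : Fin 3) (1 : ℝ))⟫_ℝ| -
                (1 / 2 : ℝ) * Real.sqrt (1 - ⟪L (EuclideanSpace.single (2 : Fin 3) (1 : ℝ)),
                  (EuclideanSpace.single (2 : Fin 3) (1 : ℝ))⟫_ℝ ^ 2)) * Real.pi * ρ ^ 2 +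
              C_F * (1 + h) * ρ)
    {σ₁ σ₂ : ℤ → ℤ} (hσ₁ : IsHaggSeq σ₁) (hσ₂ : IsHaggSeq σ₂) (hfcc : BothFcc σ₁ σ₂)
    (L₁ L₂ : E3 ≃ₗᵢ[ℝ] E3) (s₁ s₂ : E3) {A₁ A₂ : ℤ → (E3 ≃ₗᵢ[ℝ] E3)} {u₁ u₂ : ℤ → E3}
    (hfr₁ : BilayerFramesAt L₁ s₁ σ₁ A₁ u₁) (hfr₂ : BilayerFramesAt L₂ s₂ σ₂ A₂ u₂)
    {c : ℤ → ℤ → ℝ} {m : ℤ → ℤ → E3} (hadm : BilayerChargeAdmissible A₁ A₂ c m)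
    (hgen : ¬ InResidualClass (A₁ 0) (A₂ 0) (u₁ 0) (u₂ 0))
    (hβ : ¬ Sigma9OneSidedAt (A₁ 0) (A₂ 0) ∧ ¬ Sigma9OneSidedDownAt (A₁ 0) (A₂ 0) ∧ ¬ Sigma9TiltAt (A₁ 0) (A₂ 0) ∧
      ¬ Sigma9TiltDownAt (A₁ 0) (A₂ 0) ∧ ¬ Sigma9WideAt (A₁ 0) (A₂ 0) ∧ ¬ Sigma9WideDownAt (A₁ 0) (A₂ 0) ∧
      ¬ SeparatedWideAt (A₁ 0) (A₂ 0)) :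
    BilayerWallAt (max (C_F + 60 * Real.sqrt 2 * Real.pi) ((2 * 2000 * (1 + 2 * (R₀ - 10)) + 3456 + 1152 * (R₀ + 1)) / 2))
      R₀ σ₁ σ₂ L₁ L₂ s₁ s₂ c := by
  obtain ⟨P₁, P₂, -, -, hS₁, hS₂⟩ := exists_affine_fcc_pair_of_bothFcc L₁ L₂ s₁ s₂ hσ₁ hσ₂ hfcc
  have hR0 : 0 ≤ R₀ := by linarith
  have hR1 : 1 ≤ R₀ := by linarith
  have hR3 : 3 ≤ R₀ := by linarith
  by_cases hco : CoAx P₁ P₂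
  · by_cases hlin : P₁ '' fccRef = P₂ '' fccRef
    · -- (α=) same linear lattice: zero cell
      have hz := bilayerWallAt_of_equal_linear hσ₁ hσ₂ hS₁ hS₂ hfr₁ hfr₂ hadm hlin R₀ hR3
      refine bilayerWallAt_mono hR0 (le_trans ?_ (le_max_right _ _)) hz
      have : 0 ≤ 2 * 2000 * (1 + 2 * (R₀ - 10)) := by nlinarith
      linarith
    · -- (α≠) co-axial, distinct linear lattices: lane F's matrix
      obtain ⟨L, r₁, r₂, τ, τ', hτ, hτ', h₁, h₂, hcell⟩ :=
        hFU P₁ s₁ P₂ s₂ (affine_coax_of_coAx s₁ s₂ hco) (affine_ne_of_linear_ne hσ₁ hS₁ hlin)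
      exact bilayerWallAt_mono hR0 (le_max_left _ _)
        (bilayerWallAt_of_coaxialCell hσ₁ hσ₂ hS₁ hS₂ hfr₁ hfr₂ hadm hτ hτ' h₁ h₂ hR1 hcell)
  · -- (β) non-co-axial: lane G's payer pools
    exact bilayerWallAt_mono hR0 (le_max_right _ _)
      (bilayerWallAt_of_not_coAx_offSigma9 hs₀ hcert hDS hCP hσ₁ hσ₂ hS₁ hS₂ hfr₁ hfr₂ hadm hco hgen hβ hR₀)

end Summit.Ventures.Crystal3D.Theorems

end
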